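import Summits.RiemannHypothesis.RiemannHypothesis.Theorems.LiHeightLawLog
import Literature.NumberTheory.LFunctions.RiemannHypothesisUpTo1000X
import HarnessLib

/-!
# RiemannHypothesis / LiHeightLog — the Li height law at the tree's KERNEL-certified height `T = 10³`: UNCONDITIONAL ranges (RH-FREE)

RH-FREE [rh-li-prover].  Cell `pub/rh-li`, route `Theses/LiHeightLog.lean` (round 6, rung L-P(P1-log) «Li HEIGHT LAW,
LOGARITHMIC RANGE», CLOSED·proved).  The rung leaf `LiTheory.liHeightLawLog_holds` («RH verified to height `T ≥ 1000` ⇒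
`λ_n ≥ 0` for `1 ≤ n ≤ 2 T² log T`») and the intermediate all-range law `LiTheory.liAsymptoticLawAllRange_holds`
(«RH to `T ≥ 1000` ⇒ `|λ_n − (n/2) log n − C₁ n| ≤ 2 √n log n + liCoshDefect n T` for every `n ≥ 900`») take a verified
height as HYPOTHESIS.  The tree CERTIFIES two such heights with no named fact:

* `T = 10³` by the KERNEL (`riemannHypothesisUpTo_1000`, `RiemannHypothesisUpTo1000X.lean`: Riemann–Siegel sign certificate
  of the 649 zeros with the PROVED Gabcke remainder + Turing's method, `decide +kernel`; standard axioms only) — exactly the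
  leaf's threshold `T₀ = 1000`;
* `T = 10⁵` by compiled evaluation (`riemannHypothesisUpTo_100000`, `RiemannHypothesisUpTo100000X.lean`, 138 069 zeros;
  `native_decide` auxiliary axioms).

Instantiating at the KERNEL height gives theorems with NO hypothesis at all, standard axioms only:

* `keiperLiCoeff_nonneg_of_le_13815510` — **`λ_n ≥ 0` for every `1 ≤ n ≤ 13 815 510`** (`= ⌊2·10⁶ log 10³⌋`), checked by the
  Lean KERNEL, axioms `{propext, Classical.choice, Quot.sound}`.  The tree's previous unconditional ranges
  (`Literature/NumberTheory/LFunctions/RHCriteriaRangesRS.lean`, Brown's sub-range `n ≤ 2π(T − 4)`): `n ≤ 6 258` (kernel),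
  `n ≤ 628 293` (compiled); the certified tables of `λ_n` in print reach `n = 10⁵` (Johansson 2015).
* `abs_keiperLiCoeff_sub_liMainTerm_le_height1000` — for EVERY `n ≥ 900`, `|λ_n − (n/2) log n − C₁ n| ≤ 2 √n log n + liCoshDefect n 10³`
  (kernel); numerically `liCoshDefect n 10³ ≤ 3` for `n ≤ 10⁵` and `≤ 300` for `n ≤ 10⁶` (`liCoshDefect_height1000_le`,
  `abs_keiperLiCoeff_sub_liMainTerm_le_three`, `…_le_threeHundred`): the Keiper–Lagarias trend `(n/2) log n + C₁ n` with the
  band `2 √n log n` observed in the DATA rung's certified tables is a theorem on `900 ≤ n ≤ 10⁶`, unconditionally.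
* the same at the compiled height `T = 10⁵` (`λ_n ≥ 0` for `1 ≤ n ≤ 2.3·10¹¹`, the all-range law with `liCoshDefect n 10⁵`)
  is the sibling module `LiHeightLawLogRangesCompiled.lean` (those theorems inherit the `native_decide` axioms of
  `riemannHypothesisUpTo_100000`; this module is kernel-only, standard axioms throughout).

Numerics used: `log 10 = log 2 + log 5 ∈ (2.3025850926, 2.3025850934)` (Mathlib's nine-digit values), `log 2π ≥ 1.8`
(`FarZeroTail.log_two_pi_ge`), `π > 3.14`, `cosh x − 1 ≤ (9/16) x²` on `[0, ½]` (`BudgetLog.cosh_sub_one_le_low`).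

LABEL: RH-FREE PROOF-OF-DATA; a FINITE certified height gives FINITELY many coefficients (positivity) and an explicit
two-sided law whose defect term grows like `e^{n/2T²}`; Li's criterion is the `∀ n` statement.  Nothing here bears on the
truth of RH.
-/

noncomputable section

-- D-0017: `Summit.<S>.<S>.…` is the designed namespace of a single-problem summit.
set_option linter.dupNamespace false

namespace Summit.RiemannHypothesis.RiemannHypothesis.Theorems.LiTheory

open Literature.NumberTheory.LFunctions Literature.NumberTheory.DiophantineGeometry
open scoped Real

namespace Ranges

/-! ### Numerical constants -/

/-- `log 1000 = 3 log 10`. -/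
theorem log_thousand_eq : Real.log 1000 = 3 * Real.log 10 := by
  rw [show (1000 : ℝ) = 10 ^ 3 by norm_num, Real.log_pow]
  norm_num

/-- `2.3025850926 < log 10 < 2.3025850934` (Mathlib's nine-digit values of `log 2`, `log 5`). -/
theorem log_ten_bounds : (2.3025850926 : ℝ) < Real.log 10 ∧ Real.log 10 < 2.3025850934 := by
  rw [Real.log_ten_eq]
  constructor <;>
    linarith [Real.log_two_gt_d9, Real.log_five_gt_d9, Real.log_two_lt_d9, Real.log_five_lt_d9]

/-- `6.9077552778 < log 1000 < 6.9077552802`. -/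
theorem log_thousand_bounds : (6.9077552778 : ℝ) < Real.log 1000 ∧ Real.log 1000 < 6.9077552802 := by
  rw [log_thousand_eq]
  have h := log_ten_bounds
  constructor <;> linarith [h.1, h.2]

/-- The leaf's range at `T = 10³` contains `13 815 510 = ⌊2·10⁶·log 10³⌋` (`2·10⁶ · 6.9077552778 = 13 815 510.55…`). -/
theorem range_height1000 : (13815510 : ℝ) ≤ 2 * (1000 : ℝ) ^ 2 * Real.log 1000 := by
  have h := log_thousand_bounds.1
  nlinarith [h]

/-- The cosh-tail constant at `T = 10³`: `K(10³) = 10³ (log(10³/2π) + 1)/π + 1.24 log 10³ + 18 ≤ 1980`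
(`log(10³/2π) ≤ 6.9078 − 1.8`, `π > 3.14`; the value is `1958.7…`). -/
theorem coshTailConst_height1000_le :
    (1000 : ℝ) * (Real.log (1000 / (2 * π)) + 1) / π + 1.24 * Real.log 1000 + 18 ≤ 1980 := by
  have hπ := Real.pi_gt_d2
  have hπ0 := Real.pi_pos
  have hlog := log_thousand_bounds.2
  have h2π := FarZeroTail.log_two_pi_ge
  have hdiv : Real.log (1000 / (2 * π)) = Real.log 1000 - Real.log (2 * π) :=
    Real.log_div (by norm_num) (by positivity)
  rw [hdiv]
  have h1 : (1000 : ℝ) * (Real.log 1000 - Real.log (2 * π) + 1) / π ≤ 1945.15 := by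
    rw [div_le_iff₀ hπ0]
    nlinarith
  linarith

end Ranges

open Ranges

/-! ### Height `T = 10³` (KERNEL, standard axioms): `λ_n ≥ 0` for `n ≤ 13 815 510`, and the all-range law -/

/-- **Li's coefficients are non-negative for every `1 ≤ n ≤ 13 815 510`, unconditionally and KERNEL-checked**
(standard axioms only): the rung leaf `liHeightLawLog_holds` (RH to `T ≥ 1000` ⇒ `λ_n ≥ 0` for `n ≤ 2T² log T`) at
the tree's kernel-certified height `T = 10³` (`riemannHypothesisUpTo_1000`); `13 815 510 = ⌊2·10⁶ log 10³⌋`.  Previous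
kernel range in the tree: `n ≤ 6 258` (`keiperLiCoeff_nonneg_of_le_6258`). -/
theorem keiperLiCoeff_nonneg_of_le_13815510 {n : ℕ} (hn : 1 ≤ n) (hn' : n ≤ 13815510) :
    0 ≤ keiperLiCoeff n := by
  refine liHeightLawLog_holds (T := 1000) (by norm_num) riemannHypothesisUpTo_1000 hn ?_
  have h : (n : ℝ) ≤ 13815510 := by exact_mod_cast hn'
  exact h.trans range_height1000

/-- Li's criterion (`li_criterion_holds`: `RH ↔ ∀ n ≥ 1, λ_n ≥ 0`) holds on the initial segment `1 ≤ n ≤ 13 815 510`,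
unconditionally (kernel-checked, standard axioms). -/
theorem keiperLiCoeff_nonneg_upTo_13815510 :
    ∀ n : ℕ, 1 ≤ n → n ≤ 13815510 → 0 ≤ keiperLiCoeff n :=
  fun _ hn hn' => keiperLiCoeff_nonneg_of_le_13815510 hn hn'

/-- **The all-range Li law at height `10³`, unconditionally (KERNEL):** for EVERY `n ≥ 900`,
`|λ_n − (n/2) log n − C₁ n| ≤ 2 √n log n + liCoshDefect n 10³` — `liAsymptoticLawAllRange_holds` at
`riemannHypothesisUpTo_1000`.  The defect `liCoshDefect n 10³ = (cosh(n/(2·10⁶)) − 1)·K(10³) + (n/2) log 10³/(4π·10⁶)`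
is `≤ 3` for `n ≤ 10⁵`, `≤ 300` for `n ≤ 10⁶`, and grows like `e^{n/2·10⁶}` beyond. -/
theorem abs_keiperLiCoeff_sub_liMainTerm_le_height1000 {n : ℕ} (hn : 900 ≤ n) :
    |keiperLiCoeff n - liMainTerm n| ≤ 2 * Real.sqrt n * Real.log n + liCoshDefect n 1000 :=
  liAsymptoticLawAllRange_holds (T := 1000) (by norm_num) riemannHypothesisUpTo_1000 hn

/-- The defect at height `10³` for `n ≤ 10⁶`: `liCoshDefect n 10³ ≤ 2.8·10⁻¹⁰ n² + 2.8·10⁻⁷ n`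
(`cosh x − 1 ≤ (9/16)x²` for `x = n/(2·10⁶) ≤ ½`, `K(10³) ≤ 1980`, `log 10³ ≤ 6.9078`, `π > 3.14`). -/
theorem liCoshDefect_height1000_le {n : ℕ} (hn : n ≤ 1000000) :
    liCoshDefect n 1000 ≤ 2.8e-10 * (n : ℝ) ^ 2 + 2.8e-7 * n := by
  have hn' : (n : ℝ) ≤ 1000000 := by exact_mod_cast hn
  have hn0 : (0 : ℝ) ≤ n := Nat.cast_nonneg n
  have hπ := Real.pi_gt_d2
  have hπ0 := Real.pi_pos
  have hlog := log_thousand_bounds.2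
  have hK := coshTailConst_height1000_le
  have hK0 := BudgetLog.K_nonneg (T := 1000) le_rfl
  have hx0 : (0 : ℝ) ≤ n / (2 * (1000 : ℝ) ^ 2) := by positivity
  have hx1 : (n : ℝ) / (2 * (1000 : ℝ) ^ 2) ≤ 1 / 2 := by
    rw [div_le_iff₀ (by positivity)]
    linarith
  have hcosh := BudgetLog.cosh_sub_one_le_low hx0 hx1
  have hcosh0 : 0 ≤ Real.cosh ((n : ℝ) / (2 * (1000 : ℝ) ^ 2)) - 1 := by
    linarith [Real.one_le_cosh ((n : ℝ) / (2 * (1000 : ℝ) ^ 2))]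
  -- cosh tail ≤ (9/16) x² · 1980
  have htail : (Real.cosh ((n : ℝ) / (2 * (1000 : ℝ) ^ 2)) - 1) *
      ((1000 : ℝ) * (Real.log (1000 / (2 * π)) + 1) / π + 1.24 * Real.log 1000 + 18) ≤
      9 / 16 * ((n : ℝ) / (2 * (1000 : ℝ) ^ 2)) ^ 2 * 1980 :=
    mul_le_mul hcosh hK hK0 (by positivity)
  have hsq : ((n : ℝ) / (2 * (1000 : ℝ) ^ 2)) ^ 2 = (n : ℝ) ^ 2 / (4 * 10 ^ 12) := by ring
  -- phase tail ≤ 2.8e-7 n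
  have hphase : (n : ℝ) / 2 * (Real.log 1000 / (4 * π * (1000 : ℝ) ^ 2)) ≤ 2.8e-7 * n := by
    have h1 : Real.log 1000 / (4 * π * (1000 : ℝ) ^ 2) ≤ 5.6e-7 := by
      rw [div_le_iff₀ (by positivity)]
      nlinarith
    have h2 : (n : ℝ) / 2 * (Real.log 1000 / (4 * π * (1000 : ℝ) ^ 2)) ≤ (n : ℝ) / 2 * 5.6e-7 :=
      mul_le_mul_of_nonneg_left h1 (by positivity)
    linarith
  unfold liCoshDefect liCoshTail
  rw [hsq] at htail
  nlinarith [htail, hphase]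

/-- **Unconditional Li asymptotic law, `900 ≤ n ≤ 10⁵` (KERNEL):** `|λ_n − (n/2) log n − C₁ n| ≤ 2 √n log n + 3`. -/
theorem abs_keiperLiCoeff_sub_liMainTerm_le_three {n : ℕ} (hn : 900 ≤ n) (hn' : n ≤ 100000) :
    |keiperLiCoeff n - liMainTerm n| ≤ 2 * Real.sqrt n * Real.log n + 3 := by
  have h1 := abs_keiperLiCoeff_sub_liMainTerm_le_height1000 hn
  have h2 := liCoshDefect_height1000_le (le_trans hn' (by norm_num))
  have hn'' : (n : ℝ) ≤ 100000 := by exact_mod_cast hn'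
  have hn0 : (0 : ℝ) ≤ n := Nat.cast_nonneg n
  nlinarith

/-- **Unconditional Li asymptotic law, `900 ≤ n ≤ 10⁶` (KERNEL):** `|λ_n − (n/2) log n − C₁ n| ≤ 2 √n log n + 300`. -/
theorem abs_keiperLiCoeff_sub_liMainTerm_le_threeHundred {n : ℕ} (hn : 900 ≤ n) (hn' : n ≤ 1000000) :
    |keiperLiCoeff n - liMainTerm n| ≤ 2 * Real.sqrt n * Real.log n + 300 := by
  have h1 := abs_keiperLiCoeff_sub_liMainTerm_le_height1000 hn
  have h2 := liCoshDefect_height1000_le hn'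
  have hn'' : (n : ℝ) ≤ 1000000 := by exact_mod_cast hn'
  have hn0 : (0 : ℝ) ≤ n := Nat.cast_nonneg n
  nlinarith

end Summit.RiemannHypothesis.RiemannHypothesis.Theorems.LiTheory

end
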